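import Mathlib.Analysis.InnerProductSpace.Calculus
import Mathlib.Analysis.SpecialFunctions.Sqrt
import Literature.Topology.FourManifolds.MMSWRasmussenFacts
import Literature.Topology.FourManifolds.KnotOfClosedCurve
import Literature.Topology.FourManifolds.CurveFamilyIsotopy
import Literature.Topology.FourManifolds.GaussDiagramsRegularPosition
import Literature.Topology.FourManifolds.LeeRasmussenInvarianceProofs
import HarnessLib

/-!
# The finite approximations `D(k⃗)` of a model knot are knots in `S³`

Sibling proof file of `Literature/Topology/FourManifolds/MMSWRasmussenFacts.lean`, working
towards its named fact `Literature.Topology.FourManifolds.MMSW.eventually_approxHasRasmussen`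
(C. Manolescu, M. Marengon, S. Sarkar, M. Willis, *A generalization of Rasmussen's invariant,
with applications to surfaces in some four-manifolds*, Duke Math. J. 172 (2023) 231–311,
arXiv:1910.08195, **Thm. 1.4** (= Thm. 3.3) with **Prop. 8.2 (i)**: for a null-homologous link
`L ⊂ #ʳ(S¹ × S²)` with diagram `D`, `s₋(L) = s(D(k⃗))` for every `k ≥ ⌈(n⁺_D + 2)/2⌉`, so the
ordinary Rasmussen invariants of the finite approximations `D(k⃗)` are eventually constant).

## The printed proof, and what this file does and does not prove

MMSW's finite approximation theorem is the tip of a theory the tree does not have.  Its proof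
(arXiv v3, §§2–3) runs: (a) Willis's Khovanov complex for diagrams of links in `M_r`, built by
inserting the semi-infinite complex of the infinite full twist (Rozansky) in place of each
`1`-handle, and its finite approximation — the complex of the `S³`-link `D(k⃗)` computes it in
every fixed homological degree `d` once `k ≥ ⌈(n⁺_D + 1 - d)/2⌉`, by multicone simplifications
(delooping, crossing-removing Reidemeister I/II moves) [MMSW, Thm. 2.1, Cor. 2.2; Willis 2021];
(b) the Lee deformation of all this over `R[t]` and the fact that the Lee generators of `D(k⃗)`
are carried to unit multiples of Lee generators through the limit [MMSW, Thm. 2.10]; (c) hence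
`s(D) = s(D(k⃗))` for `k ≥ ⌈(n⁺_D + 2)/2⌉` [MMSW, Thm. 3.3], i.e. Prop. 8.2 (i).  None of (a)–(c)
exists on the tree's combinatorial `GaussDiagram`/`KhComplex`/`LeeRasmussen` layer (no
Khovanov complexes of full twists, no inverse systems of complexes, no twist-region diagrams),
and the identification of the tree's `finiteApprox r k K` — the twist spread over the planar
domain by `u(z)^k` and drawn by `draw` — with MMSW's `D(k⃗)` (twists inserted at membranes) is a
further isotopy argument in `M_r` and `S³`.  So the named fact is NOT discharged here.

What IS proved here is the part of `eventually_approxHasRasmussen` that the paper takes for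
granted ("the link `D(k⃗) ⊂ S³`") but the tree's statement packages explicitly:

* `MMSW.approxMap r k` — the picture map `Φ_k = toSphereThree ∘ draw r ∘ sphereTwist r k : ℝ⁴ → 𝕊³`
  with `finiteApprox r k K = Φ_k ∘ K` (`finiteApprox_eq_approxMap_comp`), smooth (read in `ℝ⁴`)
  at every point off the cores `w = 0` and the poles `z = c_j` (`contDiffAt_coe_approxMap`:
  the twist unit `u(z)`, `z ↦ z^k`, `drawC = (Re z + C_r) w̄/|w|` and the inverse stereographic
  projection are smooth there);
* `MMSW.unpicture r k` — an explicit **smooth left inverse** of `Φ_k` on `M_r ∖ {cores}`: read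
  the planar point `P` and height `h` off the stereographic coordinates (`stereoC`, `stereoH`),
  put `z = (|P| - C_r) + i h` (`liftZ`; `|drawC| = Re z + C_r` as `Re z > -C_r` on `M_r`,
  `re_zC_add_drawRadius_pos`, `norm_drawC`), recover `|w| = √(1 - g_r(z))` from `G_r = 1`
  (`planarPot`, `one_sub_planarPot_zC`) and `w/|w| = P̄/|P|` (`conj_drawC_div_norm`), and untwist
  by `σ^{-k}`: `unpicture_coe_approxMap` (`unpicture ∘ Φ_k = id` on `M_r` off the cores) and
  `contDiffAt_unpicture_coe_approxMap` (smoothness there);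
* `MMSW.IsModelKnot.isRegularClosedCurve_finiteApprox` — hence `θ ↦ D(k⃗)(cos θ, sin θ)` is a
  regular simple closed curve on `S³` for every model knot `K` missing the cores (chain rule
  through the left inverse; `K` is an injective immersion), and
  `MMSW.IsModelKnot.exists_knot_coe_eq_finiteApprox` — **`D(k⃗)` is a knot**
  (`IsRegularClosedCurve.toKnot`, `KnotOfClosedCurve`): `∃ K₃ : Knot, ⇑K₃ = finiteApprox r k K`;
* `MMSW.IsModelKnot.exists_approxHasRasmussen` — with the tree's (proved) general position
  theorem `Knot.exists_hasGaussDiagram_of_isIsotopic_holds`: **every finite approximation has a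
  Rasmussen invariant**, `∀ k, ∃ s, ApproxHasRasmussen r k K s`; and `ApproxHasRasmussen.unique`
  — that `s` is unique given Reidemeister's theorem (`Knot.reidemeister`, hypothesis), by
  `Knot.existsUnique_hasRasmussenInvariant` and the proved invariance
  `GaussDiagram.rasmussenInvariant_eq_of_equiv_holds`.

* `MMSW.IsModelKnot.sphereTwist_comp`, `MMSW.IsModelIsotopic.sphereTwist_comp`,
  `MMSW.hasSMinus_sphereTwist_comp_iff`, `MMSW.hasSPlus_sphereTwist_comp_iff`,
  `MMSWRasmussen.nonempty_sphereTwist_comp` — **the sphere twists `σ^j` act on model knots and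
  `s₋`, `s₊` are invariant under them** (MMSW Thm. 2.8 for the Dehn twists along the belt
  spheres: `D(k⃗)` of `σ^j ∘ K` is `D(k⃗ + j⃗)` of `K`, so eventual values agree; `ρ ∘ σ^j = σ^{-j} ∘ ρ`
  for `s₊`), using the smoothness of `σ^j` near `M_r` and its inverse `σ^{-j}`.

* `MMSW.exists_knot_isIsotopic_finiteApprox`, `MMSW.approxHasRasmussen_iff_of_isotopy` —
  **finite approximations along an isotopy through core-missing model knots are ambient
  isotopic knots in `S³`**, hence have the same Rasmussen invariants: the picture map carries the
  isotopy to a smooth family of regular simple closed curves, and the tree's isotopy extension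
  theorem (`IsRegularClosedCurve.isIsotopic_of_family`, `CurveFamilyIsotopy` /
  `IsotopyExtension`) applies.  (Isotopies crossing a core — MW's surgery-wrap move — are not
  covered; they need the stabilisation.)

* `MMSW.exists_forall_approxHasRasmussen_zero_left` — **the case `r = 0` of
  `eventually_approxHasRasmussen`, proved**: with no handles `σ^k = id` and `D(k⃗) = D(0⃗)`
  (`finiteApprox_zero_left`), so the `s` of `D(0⃗)` serves for every `k`; hence every
  core-missing model knot in `M_0 ≅ S³` has an `s₋` (`exists_hasSMinus_zero_left`; MMSW Ex. 8.3).

What remains of `eventually_approxHasRasmussen` after this file is exactly the stabilisation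
statement for `r ≥ 1`: the `s` of `exists_approxHasRasmussen` can be taken independent of
`k ≥ k₀`.

## References

* C. Manolescu, M. Marengon, S. Sarkar, M. Willis, Duke Math. J. 172 (2023) 231–311,
  arXiv:1910.08195: §2.1 (diagrams, `D(k⃗)`), §2.3 and Thm. 2.8 (`σ_i`), Thm. 2.1, Cor. 2.2,
  Thm. 2.10, Def. 3.1, Thm. 3.3, Thm. 1.4, Def. 8.1, Prop. 8.2. [ManolescuMarengonSarkarWillis2023]
* M. Willis, *Khovanov homology for links in `#ʳ(S² × S¹)`*, Michigan Math. J. 70 (2021)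
  675–748, arXiv:1812.06584 (the finite approximation of the Khovanov complex).
* D. Rolfsen, *Knots and Links* (1976), §3.E (stereographic coordinates). [RolfsenKnotsLinks1976]
* R. H. Crowell, R. H. Fox, *Introduction to Knot Theory*, Ch. I §2; M. W. Hirsch,
  *Differential Topology* (1976), Ch. 1 §3 (regular simple closed curves are knots: the tree's
  `IsRegularClosedCurve.toKnot`), Ch. 8 §1, Thm. 1.3 (isotopy extension). [Hirsch1976] [HirschDT1976]
-/

open scoped Manifold ContDiff Topology ComplexConjugate
open Function Set

noncomputable section

namespace Literature.Topology.FourManifolds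

/-- Local notation: `𝔼 n` is the model Euclidean space `EuclideanSpace ℝ (Fin n)`. -/
local notation "𝔼 " n:arg => EuclideanSpace ℝ (Fin n)

/-- Local notation: `𝕊 n` is the unit sphere in `EuclideanSpace ℝ (Fin (n + 1))`. -/
local notation "𝕊 " n:arg => (Metric.sphere (0 : EuclideanSpace ℝ (Fin (n + 1))) 1)

namespace MMSW

open Literature.AlgebraicTopology.Homotopy.HopfFibration (zC wC ofZW zC_ofZW wC_ofZW ofZW_zC_wC
  continuous_zC continuous_wC)

variable {r : ℕ}

/-! ## Smoothness of the coordinates and of the sphere twists -/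

/-- The complex coordinate `z = x₀ + i x₁` is smooth (it is real-linear). [folklore] -/
theorem contDiff_zC {n : WithTop ℕ∞} : ContDiff ℝ n zC := by
  have h : zC = fun x : 𝔼 4 ↦ (x 0 : ℂ) + (x 1 : ℂ) * Complex.I := by
    funext x; apply Complex.ext <;> simp [zC]
  rw [h]
  have h0 : ContDiff ℝ n fun x : 𝔼 4 ↦ x 0 := contDiff_euclidean.1 contDiff_id 0
  have h1 : ContDiff ℝ n fun x : 𝔼 4 ↦ x 1 := contDiff_euclidean.1 contDiff_id 1
  exact (Complex.ofRealCLM.contDiff.comp h0).add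
    ((Complex.ofRealCLM.contDiff.comp h1).mul contDiff_const)

/-- The complex coordinate `w = x₂ + i x₃` is smooth (it is real-linear). [folklore] -/
theorem contDiff_wC {n : WithTop ℕ∞} : ContDiff ℝ n wC := by
  have h : wC = fun x : 𝔼 4 ↦ (x 2 : ℂ) + (x 3 : ℂ) * Complex.I := by
    funext x; apply Complex.ext <;> simp [wC]
  rw [h]
  have h2 : ContDiff ℝ n fun x : 𝔼 4 ↦ x 2 := contDiff_euclidean.1 contDiff_id 2
  have h3 : ContDiff ℝ n fun x : 𝔼 4 ↦ x 3 := contDiff_euclidean.1 contDiff_id 3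
  exact (Complex.ofRealCLM.contDiff.comp h2).add
    ((Complex.ofRealCLM.contDiff.comp h3).mul contDiff_const)

/-- `ofZW` of two smooth complex functions is smooth (coordinatewise these are real and
imaginary parts). [folklore] -/
theorem _root_.ContDiffAt.ofZW {E : Type*} [NormedAddCommGroup E] [NormedSpace ℝ E]
    {f g : E → ℂ} {x : E} {n : WithTop ℕ∞} (hf : ContDiffAt ℝ n f x) (hg : ContDiffAt ℝ n g x) :
    ContDiffAt ℝ n (fun y ↦ ofZW (f y) (g y)) x := by
  rw [contDiffAt_euclidean]
  intro i
  fin_cases i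
  · exact (Complex.reCLM.contDiff.contDiffAt).comp x hf
  · exact (Complex.imCLM.contDiff.contDiffAt).comp x hf
  · exact (Complex.reCLM.contDiff.contDiffAt).comp x hg
  · exact (Complex.imCLM.contDiff.contDiffAt).comp x hg

/-- `z ↦ z ^ m` (`m ∈ ℤ`) is real-smooth on `ℂ ∖ {0}`. [folklore] -/
theorem contDiffAt_zpow_complex {z : ℂ} (hz : z ≠ 0) (m : ℤ) {n : WithTop ℕ∞} :
    ContDiffAt ℝ n (fun w : ℂ ↦ w ^ m) z := by
  have h : ContDiffAt ℂ n (fun w : ℂ ↦ w ^ m) z := by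
    rcases Int.eq_nat_or_neg m with ⟨k, rfl | rfl⟩
    · simp_rw [zpow_natCast]; exact contDiffAt_id.pow k
    · simp_rw [zpow_neg, zpow_natCast]; exact (contDiffAt_id.pow k).inv (pow_ne_zero _ hz)
  exact h.restrict_scalars ℝ

/-- One factor `(z - c)/|z - c|` of the twist unit is real-smooth away from `c`. [folklore] -/
theorem contDiffAt_unitFactor {z c : ℂ} (hz : z ≠ c) {n : WithTop ℕ∞} :
    ContDiffAt ℝ n (fun w : ℂ ↦ (w - c) / ((‖w - c‖ : ℝ) : ℂ)) z := by
  have hsub : ContDiffAt ℝ n (fun w : ℂ ↦ w - c) z := contDiffAt_id.sub contDiffAt_const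
  have hne : z - c ≠ 0 := sub_ne_zero.2 hz
  have hnorm : ContDiffAt ℝ n (fun w : ℂ ↦ ((‖w - c‖ : ℝ) : ℂ)) z :=
    (Complex.ofRealCLM.contDiff.contDiffAt).comp z (hsub.norm ℝ hne)
  have hne' : ((‖z - c‖ : ℝ) : ℂ) ≠ 0 := by
    exact_mod_cast (norm_ne_zero_iff.2 hne)
  simp_rw [div_eq_mul_inv]
  exact hsub.mul (hnorm.inv hne')

/-- The twist unit `u(z) = Π_j (z - c_j)/|z - c_j|` is real-smooth away from the hole centres.
[folklore] -/
theorem contDiffAt_twistUnit {z : ℂ} (hz : ∀ j : Fin r, z ≠ holeCentre r j) {n : WithTop ℕ∞} :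
    ContDiffAt ℝ n (twistUnit r) z := by
  have h : twistUnit r = fun w ↦ ∏ j : Fin r, (w - holeCentre r j) / ((‖w - holeCentre r j‖ : ℝ) : ℂ) := by
    funext w; rfl
  rw [h]
  exact contDiffAt_prod (fun j _ ↦ contDiffAt_unitFactor (hz j))

/-- The sphere twist `σ^k (z, w) = (z, w · u(z)^k)` is smooth away from the poles `z = c_j`
(in particular near the model boundary `M_r`). [folklore] -/
theorem contDiffAt_sphereTwist {x : 𝔼 4} (hx : ∀ j : Fin r, zC x ≠ holeCentre r j) (k : ℤ)
    {n : WithTop ℕ∞} : ContDiffAt ℝ n (sphereTwist r k) x := by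
  have hu : ContDiffAt ℝ n (fun y : 𝔼 4 ↦ twistUnit r (zC y) ^ k) x :=
    (contDiffAt_zpow_complex (twistUnit_ne_zero hx) k).comp x
      ((contDiffAt_twistUnit hx).comp x contDiff_zC.contDiffAt)
  exact contDiff_zC.contDiffAt.ofZW (contDiff_wC.contDiffAt.mul hu)

/-! ## Smoothness of the standard picture and of the finite approximation map -/

/-- The planar position `drawC` of the standard picture is smooth off the cores `w = 0`.
[folklore] -/
theorem contDiffAt_drawC {x : 𝔼 4} (hw : wC x ≠ 0) {n : WithTop ℕ∞} :
    ContDiffAt ℝ n (drawC r) x := by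
  unfold drawC
  have h1 : ContDiffAt ℝ n (fun y : 𝔼 4 ↦ (((zC y).re + drawRadius r : ℝ) : ℂ)) x :=
    (Complex.ofRealCLM.contDiff.contDiffAt).comp x
      (((Complex.reCLM.contDiff.contDiffAt).comp x contDiff_zC.contDiffAt).add contDiffAt_const)
  have h2 : ContDiffAt ℝ n (fun y : 𝔼 4 ↦ conj (wC y)) x :=
    (Complex.conjCLE.contDiff.contDiffAt).comp x contDiff_wC.contDiffAt
  have h3 : ContDiffAt ℝ n (fun y : 𝔼 4 ↦ ((‖wC y‖ : ℝ) : ℂ)) x :=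
    (Complex.ofRealCLM.contDiff.contDiffAt).comp x (contDiff_wC.contDiffAt.norm ℝ hw)
  have hne : ((‖wC x‖ : ℝ) : ℂ) ≠ 0 := by exact_mod_cast (norm_ne_zero_iff.2 hw)
  simp_rw [div_eq_mul_inv]
  exact (h1.mul h2).mul (h3.inv hne)

/-- The standard picture `draw = (drawC, Im z)` is smooth off the cores. [folklore] -/
theorem contDiffAt_draw {x : 𝔼 4} (hw : wC x ≠ 0) {n : WithTop ℕ∞} :
    ContDiffAt ℝ n (draw r) x := by
  unfold draw
  exact (((Complex.reCLM.contDiff.contDiffAt).comp x (contDiffAt_drawC hw)).prodMk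
    ((Complex.imCLM.contDiff.contDiffAt).comp x (contDiffAt_drawC hw))).prodMk
    ((Complex.imCLM.contDiff.contDiffAt).comp x contDiff_zC.contDiffAt)

/-- The inverse stereographic projection, read in `ℝ⁴ ⊇ 𝕊³`, is smooth. [folklore] -/
theorem contDiff_coe_toSphereThree {n : WithTop ℕ∞} :
    ContDiff ℝ n (fun q : (ℝ × ℝ) × ℝ ↦ ((toSphereThree q.1 q.2 : 𝕊 3) : 𝔼 4)) := by
  have hS : ∀ q : (ℝ × ℝ) × ℝ, q.1.1 ^ 2 + q.1.2 ^ 2 + q.2 ^ 2 + 1 ≠ 0 := fun q ↦ by positivity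
  have hp1 : ContDiff ℝ n fun q : (ℝ × ℝ) × ℝ ↦ q.1.1 := contDiff_fst.comp contDiff_fst
  have hp2 : ContDiff ℝ n fun q : (ℝ × ℝ) × ℝ ↦ q.1.2 := contDiff_snd.comp contDiff_fst
  have hh : ContDiff ℝ n fun q : (ℝ × ℝ) × ℝ ↦ q.2 := contDiff_snd
  have hsum : ContDiff ℝ n fun q : (ℝ × ℝ) × ℝ ↦ q.1.1 ^ 2 + q.1.2 ^ 2 + q.2 ^ 2 + 1 :=
    (((hp1.pow 2).add (hp2.pow 2)).add (hh.pow 2)).add contDiff_const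
  simp_rw [coe_toSphereThree]
  refine (contDiff_const.div hsum hS).smul ?_
  rw [contDiff_euclidean]
  intro i
  fin_cases i
  · simpa using contDiff_const.mul hp1
  · simpa using contDiff_const.mul hp2
  · simpa using contDiff_const.mul hh
  · simpa using (((hp1.pow 2).add (hp2.pow 2)).add (hh.pow 2)).sub contDiff_const

/-- **The finite approximation map** `Φ_k = toSphereThree ∘ draw ∘ σ^k : ℝ⁴ → 𝕊³`, so that
`finiteApprox r k K = Φ_k ∘ K` (`finiteApprox_eq_approxMap_comp`).
[cite: ManolescuMarengonSarkarWillis2023, §2.1 and Prop. 8.2] -/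
def approxMap (r : ℕ) (k : ℤ) (x : 𝔼 4) : 𝕊 3 :=
  toSphereThree (draw r (sphereTwist r k x)).1 (draw r (sphereTwist r k x)).2

/-- `finiteApprox r k K = approxMap r k ∘ K`. [folklore] -/
theorem finiteApprox_eq_approxMap_comp (r : ℕ) (k : ℤ) (K : 𝕊 1 → 𝔼 4) :
    finiteApprox r k K = approxMap r k ∘ K :=
  rfl

/-- The finite approximation map, read in `ℝ⁴`, is smooth at every point off the cores and the
poles (in particular along a model knot missing the cores). [folklore] -/
theorem contDiffAt_coe_approxMap {x : 𝔼 4} (hx : ∀ j : Fin r, zC x ≠ holeCentre r j)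
    (hw : wC x ≠ 0) (k : ℤ) {n : WithTop ℕ∞} :
    ContDiffAt ℝ n (fun y ↦ ((approxMap r k y : 𝕊 3) : 𝔼 4)) x := by
  have hw' : wC (sphereTwist r k x) ≠ 0 := by
    rw [wC_sphereTwist]
    exact mul_ne_zero hw (zpow_ne_zero k (twistUnit_ne_zero hx))
  have hd : ContDiffAt ℝ n (fun y ↦ draw r (sphereTwist r k y)) x :=
    (contDiffAt_draw hw').comp x (contDiffAt_sphereTwist hx k)
  exact contDiff_coe_toSphereThree.contDiffAt.comp x hd

/-! ## A smooth left inverse of the finite approximation map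

The standard picture forgets `|w|`, which on `M_r` is recovered from `z` as `√(1 - g_r(z))`;
everything else is read off the stereographic coordinates.  The resulting map
`unpicture r k : ℝ⁴ → ℝ⁴` is smooth near, and a left inverse of `approxMap r k` on, the part of
the model boundary off the cores — which is all that is needed to see that `approxMap r k`
restricts to an injective immersion along a model knot missing the cores. -/

/-- The planar stereographic coordinate of `ℝ⁴ ⊇ 𝕊³` (from the north pole), as a complex
number: `(x₀ + i x₁)/(1 - x₃)`; on `𝕊³` its components are the tree's `planarProjection`
(`GaussDiagrams`). [cite: RolfsenKnotsLinks1976, §3.E] -/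
def stereoC (y : 𝔼 4) : ℂ :=
  (((1 - y 3)⁻¹ * y 0 : ℝ) : ℂ) + (((1 - y 3)⁻¹ * y 1 : ℝ) : ℂ) * Complex.I

/-- The stereographic height `x₂/(1 - x₃)` on `ℝ⁴ ⊇ 𝕊³`; on `𝕊³` it is the tree's `height`.
[cite: RolfsenKnotsLinks1976, §3.E] -/
def stereoH (y : 𝔼 4) : ℝ :=
  (1 - y 3)⁻¹ * y 2

/-- Real part of `stereoC`. [folklore] -/
@[simp] theorem stereoC_re (y : 𝔼 4) : (stereoC y).re = (1 - y 3)⁻¹ * y 0 := by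
  simp only [stereoC, Complex.add_re, Complex.ofReal_re, Complex.mul_re, Complex.I_re,
    Complex.I_im, Complex.ofReal_im]
  ring

/-- Imaginary part of `stereoC`. [folklore] -/
@[simp] theorem stereoC_im (y : 𝔼 4) : (stereoC y).im = (1 - y 3)⁻¹ * y 1 := by
  simp only [stereoC, Complex.add_im, Complex.ofReal_re, Complex.mul_im, Complex.I_re,
    Complex.I_im, Complex.ofReal_im]
  ring

/-- `stereoC` inverts `toSphereThree` on the planar coordinate. [cite: RolfsenKnotsLinks1976, §3.E] -/
theorem stereoC_toSphereThree (p : ℝ × ℝ) (h : ℝ) :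
    stereoC ((toSphereThree p h : 𝕊 3) : 𝔼 4) = ((p.1 : ℝ) : ℂ) + ((p.2 : ℝ) : ℂ) * Complex.I := by
  have h1 : (1 - ((toSphereThree p h : 𝕊 3) : 𝔼 4) 3)⁻¹ * ((toSphereThree p h : 𝕊 3) : 𝔼 4) 0 =
      p.1 :=
    congrArg Prod.fst (planarProjection_toSphereThree p h)
  have h2 : (1 - ((toSphereThree p h : 𝕊 3) : 𝔼 4) 3)⁻¹ * ((toSphereThree p h : 𝕊 3) : 𝔼 4) 1 =
      p.2 :=
    congrArg Prod.snd (planarProjection_toSphereThree p h)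
  rw [stereoC, h1, h2]

/-- `stereoH` inverts `toSphereThree` on the height. [cite: RolfsenKnotsLinks1976, §3.E] -/
theorem stereoH_toSphereThree (p : ℝ × ℝ) (h : ℝ) :
    stereoH ((toSphereThree p h : 𝕊 3) : 𝔼 4) = h :=
  height_toSphereThree p h

/-- The planar potential `g_r(z) = |z|²/(40(r+1))² + Σ_j 1/|z - c_j|²`, so that
`G_r(z, w) = g_r(z) + |w|²` (`levelFun_eq_planarPot_add`). [folklore] -/
def planarPot (r : ℕ) (z : ℂ) : ℝ :=
  Complex.normSq z / (40 * ((r : ℝ) + 1)) ^ 2 + ∑ j : Fin r, 1 / Complex.normSq (z - holeCentre r j)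

/-- `G_r = g_r(z) + |w|²`. [folklore] -/
theorem levelFun_eq_planarPot_add (x : 𝔼 4) :
    levelFun r x = planarPot r (zC x) + Complex.normSq (wC x) := by
  rw [levelFun_eq, planarPot]

/-- The `z`-coordinate of the model point drawn at `y`: `z = (|P| - C_r) + i h`,
`P = stereoC y`, `h = stereoH y`. [folklore] -/
def liftZ (r : ℕ) (y : 𝔼 4) : ℂ :=
  ((‖stereoC y‖ - drawRadius r : ℝ) : ℂ) + ((stereoH y : ℝ) : ℂ) * Complex.I

/-- The `w`-coordinate of the model point drawn at `y`: `w = √(1 - g_r(z)) · P̄/|P|`. [folklore] -/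
def liftW (r : ℕ) (y : 𝔼 4) : ℂ :=
  ((Real.sqrt (1 - planarPot r (liftZ r y)) : ℝ) : ℂ) *
    (conj (stereoC y) / ((‖stereoC y‖ : ℝ) : ℂ))

/-- **The left inverse of the finite approximation map**: undo the stereographic projection,
read `z` and `arg w̄` off the picture, recover `|w| = √(1 - g_r(z))`, and untwist by `σ^{-k}`.
[folklore] -/
def unpicture (r : ℕ) (k : ℤ) (y : 𝔼 4) : 𝔼 4 :=
  sphereTwist r (-k) (ofZW (liftZ r y) (liftW r y))

/-- On the model boundary `Re z > -C_r`: `|z| ≤ 40(r+1) < 100(r+1) = C_r` since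
`|z|²/(40(r+1))² ≤ G_r = 1`. [folklore] -/
theorem re_zC_add_drawRadius_pos {x : 𝔼 4} (hx : x ∈ modelBoundary r) :
    0 < (zC x).re + drawRadius r := by
  have hs : 0 ≤ ∑ j : Fin r, 1 / Complex.normSq (zC x - holeCentre r j) :=
    Finset.sum_nonneg fun j _ ↦ one_div_nonneg.2 (Complex.normSq_nonneg _)
  have hwn : 0 ≤ Complex.normSq (wC x) := Complex.normSq_nonneg _
  have hlev := hx.2
  rw [levelFun_eq] at hlev
  have hpos : (0 : ℝ) < (40 * ((r : ℝ) + 1)) ^ 2 := by positivity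
  have h1 : Complex.normSq (zC x) / (40 * ((r : ℝ) + 1)) ^ 2 ≤ 1 := by linarith
  have h2 : Complex.normSq (zC x) ≤ (40 * ((r : ℝ) + 1)) ^ 2 := by rwa [div_le_one hpos] at h1
  have h3 : (zC x).re ^ 2 ≤ (40 * ((r : ℝ) + 1)) ^ 2 := by
    refine le_trans ?_ h2
    rw [Complex.normSq_apply]
    nlinarith [sq_nonneg (zC x).im]
  have h4 := abs_le_of_sq_le_sq' h3 (by positivity)
  rw [drawRadius]
  have hr : (0 : ℝ) ≤ (r : ℝ) := Nat.cast_nonneg r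
  nlinarith [h4.1]

/-- The picture point lies at distance `Re z + C_r` from the axis: `|drawC (z, w)| = Re z + C_r`
for `w ≠ 0`. [folklore] -/
theorem norm_drawC {x : 𝔼 4} (hw : wC x ≠ 0) (hR : 0 < (zC x).re + drawRadius r) :
    ‖drawC r x‖ = (zC x).re + drawRadius r := by
  have hwn : ‖wC x‖ ≠ 0 := norm_ne_zero_iff.2 hw
  rw [drawC, norm_div, norm_mul, Complex.norm_real, Complex.norm_real, Complex.norm_conj,
    Real.norm_eq_abs, Real.norm_eq_abs, abs_of_pos hR, abs_of_nonneg (norm_nonneg _),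
    mul_div_assoc, div_self hwn, mul_one]

/-- The direction of the picture point recovers `w/|w|`: `conj(drawC)/|drawC| = w/|w|`.
[folklore] -/
theorem conj_drawC_div_norm {x : 𝔼 4} (hw : wC x ≠ 0) (hR : 0 < (zC x).re + drawRadius r) :
    conj (drawC r x) / ((‖drawC r x‖ : ℝ) : ℂ) = wC x / ((‖wC x‖ : ℝ) : ℂ) := by
  rw [norm_drawC hw hR, drawC, map_div₀, map_mul, Complex.conj_ofReal, Complex.conj_conj,
    Complex.conj_ofReal]
  have ha : (((zC x).re + drawRadius r : ℝ) : ℂ) ≠ 0 := by exact_mod_cast hR.ne'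
  have hwn : ((‖wC x‖ : ℝ) : ℂ) ≠ 0 := by exact_mod_cast norm_ne_zero_iff.2 hw
  field_simp

/-- The planar coordinate of the finite approximation is the planar position of the twisted
point. [folklore] -/
theorem stereoC_coe_approxMap (k : ℤ) (x : 𝔼 4) :
    stereoC ((approxMap r k x : 𝕊 3) : 𝔼 4) = drawC r (sphereTwist r k x) := by
  show stereoC ((toSphereThree (draw r (sphereTwist r k x)).1
    (draw r (sphereTwist r k x)).2 : 𝕊 3) : 𝔼 4) = _
  rw [stereoC_toSphereThree]
  apply Complex.ext <;> simp [draw]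

/-- The height of the finite approximation is `Im z`. [folklore] -/
theorem stereoH_coe_approxMap (k : ℤ) (x : 𝔼 4) :
    stereoH ((approxMap r k x : 𝕊 3) : 𝔼 4) = (zC x).im := by
  show stereoH ((toSphereThree (draw r (sphereTwist r k x)).1
    (draw r (sphereTwist r k x)).2 : 𝕊 3) : 𝔼 4) = _
  rw [stereoH_toSphereThree, draw, zC_sphereTwist]

/-- `liftZ` recovers `z` from the picture of a point of `M_r` off the cores. [folklore] -/
theorem liftZ_coe_approxMap {x : 𝔼 4} (hx : x ∈ modelBoundary r) (hw : wC x ≠ 0) (k : ℤ) :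
    liftZ r ((approxMap r k x : 𝕊 3) : 𝔼 4) = zC x := by
  have hx' : sphereTwist r k x ∈ modelBoundary r := sphereTwist_mem_modelBoundary hx k
  have hw' : wC (sphereTwist r k x) ≠ 0 := by
    rw [wC_sphereTwist]
    exact mul_ne_zero hw (zpow_ne_zero k (twistUnit_ne_zero (zC_ne_holeCentre hx.1)))
  have hR : 0 < (zC (sphereTwist r k x)).re + drawRadius r := re_zC_add_drawRadius_pos hx'
  rw [liftZ, stereoC_coe_approxMap, stereoH_coe_approxMap, norm_drawC hw' hR, zC_sphereTwist]
  apply Complex.ext <;> simp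

/-- On `M_r`, `1 - g_r(z) = |w|²`. [folklore] -/
theorem one_sub_planarPot_zC {x : 𝔼 4} (hx : x ∈ modelBoundary r) :
    1 - planarPot r (zC x) = Complex.normSq (wC x) := by
  have h := hx.2
  rw [levelFun_eq_planarPot_add] at h
  linarith

/-- `liftW` recovers the (twisted) `w` from the picture of a point of `M_r` off the cores.
[folklore] -/
theorem liftW_coe_approxMap {x : 𝔼 4} (hx : x ∈ modelBoundary r) (hw : wC x ≠ 0) (k : ℤ) :
    liftW r ((approxMap r k x : 𝕊 3) : 𝔼 4) = wC (sphereTwist r k x) := by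
  have hx' : sphereTwist r k x ∈ modelBoundary r := sphereTwist_mem_modelBoundary hx k
  have hw' : wC (sphereTwist r k x) ≠ 0 := by
    rw [wC_sphereTwist]
    exact mul_ne_zero hw (zpow_ne_zero k (twistUnit_ne_zero (zC_ne_holeCentre hx.1)))
  have hR : 0 < (zC (sphereTwist r k x)).re + drawRadius r := re_zC_add_drawRadius_pos hx'
  have hpot : 1 - planarPot r (zC x) = Complex.normSq (wC (sphereTwist r k x)) := by
    rw [← zC_sphereTwist k x]
    exact one_sub_planarPot_zC hx'
  rw [liftW, liftZ_coe_approxMap hx hw, hpot, stereoC_coe_approxMap, conj_drawC_div_norm hw' hR,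
    ← Complex.norm_def]
  have hwn : ((‖wC (sphereTwist r k x)‖ : ℝ) : ℂ) ≠ 0 := by exact_mod_cast norm_ne_zero_iff.2 hw'
  field_simp

/-- **`unpicture r k` is a left inverse of `approxMap r k` on the model boundary off the
cores.** [folklore] -/
theorem unpicture_coe_approxMap {x : 𝔼 4} (hx : x ∈ modelBoundary r) (hw : wC x ≠ 0) (k : ℤ) :
    unpicture r k ((approxMap r k x : 𝕊 3) : 𝔼 4) = x := by
  rw [unpicture, liftZ_coe_approxMap hx hw, liftW_coe_approxMap hx hw, ← zC_sphereTwist k x,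
    ofZW_zC_wC, sphereTwist_neg_sphereTwist hx.1]

/-! ### Smoothness of the left inverse near the picture -/

/-- A complex-valued function assembled from two smooth real functions is smooth. [folklore] -/
theorem _root_.ContDiffAt.ofReal_add_ofReal_mul_I {E : Type*} [NormedAddCommGroup E]
    [NormedSpace ℝ E] {f g : E → ℝ} {x : E} {n : WithTop ℕ∞} (hf : ContDiffAt ℝ n f x)
    (hg : ContDiffAt ℝ n g x) :
    ContDiffAt ℝ n (fun y ↦ ((f y : ℝ) : ℂ) + ((g y : ℝ) : ℂ) * Complex.I) x :=
  ((Complex.ofRealCLM.contDiff.contDiffAt).comp x hf).add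
    (((Complex.ofRealCLM.contDiff.contDiffAt).comp x hg).mul contDiffAt_const)

/-- `stereoC` is smooth off the hyperplane `x₃ = 1`. [folklore] -/
theorem contDiffAt_stereoC {y : 𝔼 4} (hy : 1 - y 3 ≠ 0) {n : WithTop ℕ∞} :
    ContDiffAt ℝ n stereoC y := by
  have h3 : ContDiffAt ℝ n (fun y : 𝔼 4 ↦ (1 - y 3)⁻¹) y :=
    (contDiffAt_const.sub (contDiff_euclidean.1 contDiff_id 3).contDiffAt).inv hy
  exact (h3.mul (contDiff_euclidean.1 contDiff_id 0).contDiffAt).ofReal_add_ofReal_mul_I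
    (h3.mul (contDiff_euclidean.1 contDiff_id 1).contDiffAt)

/-- `stereoH` is smooth off the hyperplane `x₃ = 1`. [folklore] -/
theorem contDiffAt_stereoH {y : 𝔼 4} (hy : 1 - y 3 ≠ 0) {n : WithTop ℕ∞} :
    ContDiffAt ℝ n stereoH y := by
  have h3 : ContDiffAt ℝ n (fun y : 𝔼 4 ↦ (1 - y 3)⁻¹) y :=
    (contDiffAt_const.sub (contDiff_euclidean.1 contDiff_id 3).contDiffAt).inv hy
  have h2 : ContDiffAt ℝ n (fun y : 𝔼 4 ↦ y 2) y := (contDiff_euclidean.1 contDiff_id 2).contDiffAt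
  exact h3.mul h2

/-- `normSq : ℂ → ℝ` is real-smooth. [folklore] -/
theorem contDiff_normSq {n : WithTop ℕ∞} : ContDiff ℝ n Complex.normSq := by
  have h : (Complex.normSq : ℂ → ℝ) = fun z ↦ ‖z‖ ^ 2 := by
    funext z; exact Complex.normSq_eq_norm_sq z
  rw [h]
  exact contDiff_norm_sq ℝ

/-- The planar potential is smooth away from the hole centres. [folklore] -/
theorem contDiffAt_planarPot {z : ℂ} (hz : ∀ j : Fin r, z ≠ holeCentre r j) {n : WithTop ℕ∞} :
    ContDiffAt ℝ n (planarPot r) z := by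
  unfold planarPot
  refine (contDiff_normSq.contDiffAt.div_const _).add (ContDiffAt.sum fun j _ ↦ ?_)
  have hne : Complex.normSq (z - holeCentre r j) ≠ 0 :=
    (Complex.normSq_pos.2 (sub_ne_zero.2 (hz j))).ne'
  simp_rw [one_div]
  exact (contDiff_normSq.contDiffAt.comp z (contDiffAt_id.sub contDiffAt_const)).inv hne

/-- `liftZ` is smooth where the stereographic coordinates are and the planar point is off the
axis. [folklore] -/
theorem contDiffAt_liftZ {y : 𝔼 4} (hy : 1 - y 3 ≠ 0) (hP : stereoC y ≠ 0) {n : WithTop ℕ∞} :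
    ContDiffAt ℝ n (liftZ r) y :=
  (((contDiffAt_stereoC hy).norm ℝ hP).sub contDiffAt_const).ofReal_add_ofReal_mul_I
    (contDiffAt_stereoH hy)

/-- `liftW` is smooth where moreover `z` is off the poles and `1 - g_r(z) ≠ 0`. [folklore] -/
theorem contDiffAt_liftW {y : 𝔼 4} (hy : 1 - y 3 ≠ 0) (hP : stereoC y ≠ 0)
    (hz : ∀ j : Fin r, liftZ r y ≠ holeCentre r j) (hpot : 1 - planarPot r (liftZ r y) ≠ 0)
    {n : WithTop ℕ∞} : ContDiffAt ℝ n (liftW r) y := by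
  have h1 : ContDiffAt ℝ n (fun y ↦ Real.sqrt (1 - planarPot r (liftZ r y))) y :=
    (contDiffAt_const.sub ((contDiffAt_planarPot hz).comp y (contDiffAt_liftZ hy hP))).sqrt hpot
  have h2 : ContDiffAt ℝ n (fun y ↦ conj (stereoC y)) y :=
    (Complex.conjCLE.contDiff.contDiffAt).comp y (contDiffAt_stereoC hy)
  have h3 : ContDiffAt ℝ n (fun y ↦ ((‖stereoC y‖ : ℝ) : ℂ)) y :=
    (Complex.ofRealCLM.contDiff.contDiffAt).comp y ((contDiffAt_stereoC hy).norm ℝ hP)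
  have hne : ((‖stereoC y‖ : ℝ) : ℂ) ≠ 0 := by exact_mod_cast norm_ne_zero_iff.2 hP
  unfold liftW
  simp_rw [div_eq_mul_inv]
  exact ((Complex.ofRealCLM.contDiff.contDiffAt).comp y h1).mul (h2.mul (h3.inv hne))

/-- **The left inverse is smooth** at every point where the stereographic coordinates are
defined, the planar point is off the axis, `z` is off the poles and `1 - g_r(z) ≠ 0`.
[folklore] -/
theorem contDiffAt_unpicture {y : 𝔼 4} (hy : 1 - y 3 ≠ 0) (hP : stereoC y ≠ 0)
    (hz : ∀ j : Fin r, liftZ r y ≠ holeCentre r j) (hpot : 1 - planarPot r (liftZ r y) ≠ 0)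
    (k : ℤ) {n : WithTop ℕ∞} : ContDiffAt ℝ n (unpicture r k) y := by
  have hz' : ∀ j : Fin r, zC (ofZW (liftZ r y) (liftW r y)) ≠ holeCentre r j := by
    simpa only [zC_ofZW] using hz
  exact (contDiffAt_sphereTwist hz' (-k)).comp y
    ((contDiffAt_liftZ hy hP).ofZW (contDiffAt_liftW hy hP hz hpot))

/-- The inverse stereographic projection misses the north pole: `1 - x₃ = 2/(|p|² + h² + 1)`.
[folklore] -/
theorem one_sub_coe_toSphereThree_three (p : ℝ × ℝ) (h : ℝ) :
    1 - ((toSphereThree p h : 𝕊 3) : 𝔼 4) 3 = 2 / (p.1 ^ 2 + p.2 ^ 2 + h ^ 2 + 1) := by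
  have hS : p.1 ^ 2 + p.2 ^ 2 + h ^ 2 + 1 ≠ 0 := by positivity
  simp [coe_toSphereThree]
  field_simp
  ring

/-- **The left inverse is smooth at the picture of every point of `M_r` off the cores.**
[folklore] -/
theorem contDiffAt_unpicture_coe_approxMap {x : 𝔼 4} (hx : x ∈ modelBoundary r)
    (hw : wC x ≠ 0) (k : ℤ) {n : WithTop ℕ∞} :
    ContDiffAt ℝ n (unpicture r k) ((approxMap r k x : 𝕊 3) : 𝔼 4) := by
  have hx' : sphereTwist r k x ∈ modelBoundary r := sphereTwist_mem_modelBoundary hx k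
  have hw' : wC (sphereTwist r k x) ≠ 0 := by
    rw [wC_sphereTwist]
    exact mul_ne_zero hw (zpow_ne_zero k (twistUnit_ne_zero (zC_ne_holeCentre hx.1)))
  have hR : 0 < (zC (sphereTwist r k x)).re + drawRadius r := re_zC_add_drawRadius_pos hx'
  refine contDiffAt_unpicture ?_ ?_ ?_ ?_ k
  · show 1 - ((toSphereThree (draw r (sphereTwist r k x)).1
      (draw r (sphereTwist r k x)).2 : 𝕊 3) : 𝔼 4) 3 ≠ 0
    rw [one_sub_coe_toSphereThree_three]
    positivity
  · rw [stereoC_coe_approxMap, ← norm_ne_zero_iff, norm_drawC hw' hR]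
    exact hR.ne'
  · rw [liftZ_coe_approxMap hx hw]
    exact zC_ne_holeCentre hx.1
  · rw [liftZ_coe_approxMap hx hw, one_sub_planarPot_zC hx]
    exact (Complex.normSq_pos.2 hw).ne'

/-! ## The finite approximations are knots -/

/-- The velocity of a model knot, as a `2π`-periodic curve `θ ↦ K (cos θ, sin θ)` in `ℝ⁴`, never
vanishes (`K` and `circlePoint` both have injective differentials). [folklore] -/
theorem IsModelKnot.deriv_comp_circlePoint_ne_zero {K : 𝕊 1 → 𝔼 4} (hK : IsModelKnot r K)
    (θ : ℝ) : deriv (fun t ↦ K (circlePoint t)) θ ≠ 0 := by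
  intro h0
  have hn : (∞ : WithTop ℕ∞) ≠ 0 := by simp
  have hcomp : mfderiv 𝓘(ℝ, ℝ) 𝓘(ℝ, 𝔼 4) (K ∘ circlePoint) θ =
      (mfderiv (𝓡 1) 𝓘(ℝ, 𝔼 4) K (circlePoint θ)).comp (mfderiv 𝓘(ℝ, ℝ) (𝓡 1) circlePoint θ) :=
    mfderiv_comp θ (hK.1.mdifferentiableAt hn) (contMDiff_circlePoint.mdifferentiableAt hn)
  have h1 : mfderiv 𝓘(ℝ, ℝ) 𝓘(ℝ, 𝔼 4) (K ∘ circlePoint) θ (1 : ℝ) = 0 := by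
    rw [mfderiv_eq_fderiv]
    exact h0
  rw [hcomp] at h1
  have h2 : mfderiv 𝓘(ℝ, ℝ) (𝓡 1) circlePoint θ (1 : ℝ) = 0 :=
    hK.2.2.1 (circlePoint θ) (by rw [map_zero]; exact h1)
  exact mfderiv_circlePoint_apply_ne_zero θ h2

/-- **The finite approximation of a core-missing model knot is a regular simple closed curve on
`S³`**: `θ ↦ D(k⃗)(cos θ, sin θ) ∈ ℝ⁴` is `C^∞` (the picture map is smooth off the cores and the
poles), `2π`-periodic, on the unit sphere, regular and injective modulo `2π` (compose with the
smooth left inverse `unpicture r k` and use that `K` is an injective immersion). [folklore] -/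
theorem IsModelKnot.isRegularClosedCurve_finiteApprox {K : 𝕊 1 → 𝔼 4} (hK : IsModelKnot r K)
    (hw : ∀ t, wC (K t) ≠ 0) (k : ℤ) :
    IsRegularClosedCurve (fun θ ↦ ((finiteApprox r k K (circlePoint θ) : 𝕊 3) : 𝔼 4)) := by
  have hz : ∀ t, ∀ j : Fin r, zC (K t) ≠ holeCentre r j := fun t ↦ zC_ne_holeCentre (hK.mem t).1
  have hc : ContDiff ℝ ∞ fun θ ↦ K (circlePoint θ) :=
    contMDiff_iff_contDiff.1 (hK.1.comp contMDiff_circlePoint)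
  have hγ : ContDiff ℝ ∞ fun θ ↦ ((finiteApprox r k K (circlePoint θ) : 𝕊 3) : 𝔼 4) := by
    rw [contDiff_iff_contDiffAt]
    intro θ
    have h := ContDiffAt.comp (g := fun y ↦ ((approxMap r k y : 𝕊 3) : 𝔼 4))
      (f := fun t ↦ K (circlePoint t)) θ
      (contDiffAt_coe_approxMap (hz (circlePoint θ)) (hw (circlePoint θ)) k) hc.contDiffAt
    exact h
  have hleft : ∀ θ, unpicture r k ((finiteApprox r k K (circlePoint θ) : 𝕊 3) : 𝔼 4) =
      K (circlePoint θ) := fun θ ↦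
    unpicture_coe_approxMap (hK.mem _) (hw _) k
  refine ⟨hγ, fun θ ↦ by simp only [circlePoint_add_two_pi], fun θ ↦ norm_eq_of_mem_sphere _,
    fun θ h0 ↦ ?_⟩
  -- regularity: differentiate `unpicture ∘ γ = K ∘ circlePoint`
  have hd : HasDerivAt (fun θ ↦ ((finiteApprox r k K (circlePoint θ) : 𝕊 3) : 𝔼 4))
      (deriv (fun θ ↦ ((finiteApprox r k K (circlePoint θ) : 𝕊 3) : 𝔼 4)) θ) θ :=
    ((hγ.differentiable (by simp)) θ).hasDerivAt
  have hu : DifferentiableAt ℝ (unpicture r k)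
      ((finiteApprox r k K (circlePoint θ) : 𝕊 3) : 𝔼 4) :=
    (contDiffAt_unpicture_coe_approxMap (hK.mem _) (hw _) k (n := 1)).differentiableAt one_ne_zero
  have hcomp := hu.hasFDerivAt.comp_hasDerivAt θ hd
  rw [h0, map_zero] at hcomp
  have heq : (unpicture r k ∘ fun θ ↦ ((finiteApprox r k K (circlePoint θ) : 𝕊 3) : 𝔼 4)) =
      fun θ ↦ K (circlePoint θ) :=
    funext hleft
  rw [heq] at hcomp
  exact hK.deriv_comp_circlePoint_ne_zero θ hcomp.deriv

/-- **The finite approximations of a core-missing model knot are knots in `S³`** (the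
packaging conjunct `∃ K₃ : Knot, ⇑K₃ = finiteApprox r k K` of `ApproxHasRasmussen`): for a model
knot `K ⊂ M_r` missing the core circles and every `k ∈ ℤ`, `D(k⃗) = finiteApprox r k K` is the
underlying map of a smooth knot `𝕊¹ ↪ 𝕊³` — the knot of the regular simple closed curve
`isRegularClosedCurve_finiteApprox` (`IsRegularClosedCurve.toKnot`).  MMSW take this for
granted ("the link `D(k⃗) ⊂ S³`"). [cite: ManolescuMarengonSarkarWillis2023, §2.1 and Prop. 8.2] -/
theorem IsModelKnot.exists_knot_coe_eq_finiteApprox {K : 𝕊 1 → 𝔼 4} (hK : IsModelKnot r K)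
    (hw : ∀ t, wC (K t) ≠ 0) (k : ℤ) : ∃ K₃ : Knot, ⇑K₃ = finiteApprox r k K := by
  have hreg := hK.isRegularClosedCurve_finiteApprox hw k
  have hleft : ∀ θ, unpicture r k ((finiteApprox r k K (circlePoint θ) : 𝕊 3) : 𝔼 4) =
      K (circlePoint θ) := fun θ ↦
    unpicture_coe_approxMap (hK.mem _) (hw _) k
  have hinj : ∀ s t, ((finiteApprox r k K (circlePoint s) : 𝕊 3) : 𝔼 4) =
      ((finiteApprox r k K (circlePoint t) : 𝕊 3) : 𝔼 4) → circlePoint s = circlePoint t := by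
    intro s t hst
    have h := congrArg (unpicture r k) hst
    rw [hleft, hleft] at h
    exact hK.2.1 h
  refine ⟨hreg.toKnot hinj, funext fun u ↦ ?_⟩
  obtain ⟨θ, rfl⟩ := circlePoint_surjective u
  exact Subtype.ext (hreg.coe_toKnot_circlePoint hinj θ)

/-- **Every finite approximation of a core-missing model knot has a Rasmussen invariant**
(`∃ s, ApproxHasRasmussen r k K s` for EVERY `k`): `D(k⃗)` is a knot
(`exists_knot_coe_eq_finiteApprox`), every knot is isotopic to one with a Gauss diagram
(`Knot.exists_hasGaussDiagram_of_isIsotopic_holds`, general position), and that diagram has an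
`s`.  This is the soft half of `eventually_approxHasRasmussen`; the hard half — that these `s`
agree for all large `k` — is MMSW's finite approximation theorem proper (Thm. 1.4 = Thm. 3.3,
via Willis's stabilisation of the Khovanov complexes of `D(k⃗)`, Thm. 2.1 / Cor. 2.2, and the
preservation of Lee generators, Thm. 2.10). [cite: ManolescuMarengonSarkarWillis2023, Prop. 8.2 (i)] -/
theorem IsModelKnot.exists_approxHasRasmussen {K : 𝕊 1 → 𝔼 4} (hK : IsModelKnot r K)
    (hw : ∀ t, wC (K t) ≠ 0) (k : ℤ) : ∃ s : ℤ, ApproxHasRasmussen r k K s := by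
  obtain ⟨K₃, hK₃⟩ := hK.exists_knot_coe_eq_finiteApprox hw k
  obtain ⟨K', G, hiso, hG⟩ := Knot.exists_hasGaussDiagram_of_isIsotopic_holds K₃
  exact ⟨G.rasmussenInvariant, K₃, hK₃, K', G, hiso, hG, rfl⟩

/-- The Rasmussen invariant of a finite approximation is unique (Rasmussen's theorem that `s`
is a knot invariant, `Knot.existsUnique_hasRasmussenInvariant`, given Reidemeister's theorem in
Gauss-diagram form, hypothesis `hR`). [cite: ManolescuMarengonSarkarWillis2023, Prop. 8.2 (i)] -/
theorem ApproxHasRasmussen.unique (hR : Knot.reidemeister) {K : 𝕊 1 → 𝔼 4} {k : ℤ} {s s' : ℤ}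
    (h : ApproxHasRasmussen r k K s) (h' : ApproxHasRasmussen r k K s') : s = s' := by
  obtain ⟨K₃, hK₃, hs⟩ := h
  obtain ⟨K₃', hK₃', hs'⟩ := h'
  have heq : K₃ = K₃' := DFunLike.coe_injective (hK₃.trans hK₃'.symm)
  subst heq
  exact (Knot.existsUnique_hasRasmussenInvariant Knot.exists_hasGaussDiagram_of_isIsotopic_holds
    hR GaussDiagram.rasmussenInvariant_eq_of_equiv_holds K₃).unique hs hs'

/-! ## The sphere twists act on model knots, and `s₋`, `s₊` are invariant under them

MMSW, Thm. 2.8 (proof): "a Dehn twist `σ_i` simply adds a full twist onto the link diagram near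
the attaching sphere, effectively changing `k` to `k ± 1`. The stabilization … shows that this
does not affect the homology."  In the tree's definition of `HasSMinus` through eventual values
this invariance is formal: `D(k⃗)` of `σ^j(K)` is `D(k⃗ + j⃗)` of `K` (`finiteApprox_sphereTwist_comp`),
so the eventual value is the same — once `σ^j ∘ K` is known to be a model knot again and `σ^j`
to transport model isotopies, which needs the smoothness of `σ^j` proved above. -/

/-- The sphere twists keep core-missing points off the cores: `w · u(z)^k ≠ 0`. [folklore] -/
theorem wC_sphereTwist_ne_zero {x : 𝔼 4} (hx : ∀ j : Fin r, (1 : ℝ) ≤ holeTerm r j x)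
    (hw : wC x ≠ 0) (k : ℤ) : wC (sphereTwist r k x) ≠ 0 := by
  rw [wC_sphereTwist]
  exact mul_ne_zero hw (zpow_ne_zero k (twistUnit_ne_zero (zC_ne_holeCentre hx)))

/-- **`σ^k` of a model knot is a model knot**: smooth (`σ^k` is smooth near `M_r`), injective and
immersive (`σ^{-k}` is a smooth left inverse on `M_r`), with image in `M_r`.
[cite: ManolescuMarengonSarkarWillis2023, §2.3] -/
theorem IsModelKnot.sphereTwist_comp {K : 𝕊 1 → 𝔼 4} (hK : IsModelKnot r K) (k : ℤ) :
    IsModelKnot r (sphereTwist r k ∘ K) := by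
  have hz : ∀ t, ∀ j : Fin r, zC (K t) ≠ holeCentre r j := fun t ↦ zC_ne_holeCentre (hK.mem t).1
  have hn : (∞ : WithTop ℕ∞) ≠ 0 := by simp
  have hsm : ContMDiff (𝓡 1) 𝓘(ℝ, 𝔼 4) ∞ (sphereTwist r k ∘ K) := fun t ↦
    ((contDiffAt_sphereTwist (hz t) k).contMDiffAt).comp t (hK.1 t)
  have hleft : sphereTwist r (-k) ∘ (sphereTwist r k ∘ K) = K :=
    funext fun t ↦ sphereTwist_neg_sphereTwist (hK.mem t).1 k
  refine ⟨hsm, fun s t hst ↦ ?_, fun t ↦ ?_, fun t ↦ sphereTwist_mem_modelBoundary (hK.mem t) k⟩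
  · have h := congrArg (sphereTwist r (-k)) hst
    simp only [Function.comp_apply, sphereTwist_neg_sphereTwist (hK.mem _).1] at h
    exact hK.2.1 h
  · have hz' : ∀ j : Fin r, zC ((sphereTwist r k ∘ K) t) ≠ holeCentre r j := by
      simpa only [Function.comp_apply, zC_sphereTwist] using hz t
    have h1 : MDifferentiableAt 𝓘(ℝ, 𝔼 4) 𝓘(ℝ, 𝔼 4) (sphereTwist r (-k))
        ((sphereTwist r k ∘ K) t) :=
      ((contDiffAt_sphereTwist hz' (-k)).contMDiffAt (n := ∞)).mdifferentiableAt hn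
    have h2 : MDifferentiableAt (𝓡 1) 𝓘(ℝ, 𝔼 4) (sphereTwist r k ∘ K) t :=
      (hsm t).mdifferentiableAt hn
    have hcomp := mfderiv_comp t h1 h2
    rw [hleft] at hcomp
    intro u v huv
    apply hK.2.2.1 t
    rw [hcomp]
    exact congrArg (mfderiv 𝓘(ℝ, 𝔼 4) 𝓘(ℝ, 𝔼 4) (sphereTwist r (-k)) ((sphereTwist r k ∘ K) t)) huv

/-- `σ^k ∘ K` is a model knot iff `K` is (`σ^{-k}` undoes `σ^k` on `M_r`). [folklore] -/
theorem isModelKnot_sphereTwist_comp_iff (K : 𝕊 1 → 𝔼 4) (k : ℤ) :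
    IsModelKnot r (sphereTwist r k ∘ K) ↔ IsModelKnot r K := by
  refine ⟨fun h ↦ ?_, fun h ↦ h.sphereTwist_comp k⟩
  have hg : ∀ t, ∀ j : Fin r, (1 : ℝ) ≤ holeTerm r j (K t) := fun t j ↦ by
    have h1 := (h.mem t).1 j
    rwa [Function.comp_apply, holeTerm_sphereTwist] at h1
  have h' := h.sphereTwist_comp (-k)
  have heq : sphereTwist r (-k) ∘ (sphereTwist r k ∘ K) = K :=
    funext fun t ↦ sphereTwist_neg_sphereTwist (hg t) k
  rwa [heq] at h'

/-- The sphere twists do not move `z`, so they preserve null-homology. [folklore] -/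
theorem isNullHomologous_sphereTwist_comp_iff (K : 𝕊 1 → 𝔼 4) (k : ℤ) :
    IsNullHomologous r (sphereTwist r k ∘ K) ↔ IsNullHomologous r K := by
  simp only [IsNullHomologous, Function.comp_apply, zC_sphereTwist]

/-- **`σ^k` transports smooth isotopies of model knots** (compose the isotopy with the smooth
map `σ^k`). [folklore] -/
theorem IsSmoothModelIsotopy.sphereTwist_comp {K K' : 𝕊 1 → 𝔼 4}
    (h : IsSmoothModelIsotopy r K K') (k : ℤ) :
    IsSmoothModelIsotopy r (sphereTwist r k ∘ K) (sphereTwist r k ∘ K') := by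
  obtain ⟨H, hH, h0, h1, hK⟩ := h
  refine ⟨fun s ↦ sphereTwist r k ∘ H s, fun p ↦ ?_, fun s hs ↦ ?_, fun s hs ↦ ?_,
    fun s ↦ (hK s).sphereTwist_comp k⟩
  · have hz : ∀ j : Fin r, zC (H p.1 p.2) ≠ holeCentre r j :=
      zC_ne_holeCentre ((hK p.1).mem p.2).1
    exact ((contDiffAt_sphereTwist hz k).contMDiffAt).comp p (hH p)
  · show sphereTwist r k ∘ H s = _
    rw [h0 s hs]
  · show sphereTwist r k ∘ H s = _
    rw [h1 s hs]

/-- `σ^k` transports isotopy of model knots. [folklore] -/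
theorem IsModelIsotopic.sphereTwist_comp {K K' : 𝕊 1 → 𝔼 4} (h : IsModelIsotopic r K K')
    (k : ℤ) : IsModelIsotopic r (sphereTwist r k ∘ K) (sphereTwist r k ∘ K') := by
  induction h with
  | single h => exact (h.sphereTwist_comp k).isModelIsotopic
  | tail _ h ih => exact ih.trans (h.sphereTwist_comp k).isModelIsotopic

/-- `s(D(k⃗))` of `σ^j(K)` is `s(D(j⃗ + k⃗))` of `K` (for `K` in the model boundary).
[cite: ManolescuMarengonSarkarWillis2023, Thm. 2.8 (proof)] -/
theorem approxHasRasmussen_sphereTwist_comp_iff {K : 𝕊 1 → 𝔼 4}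
    (hK : ∀ t, K t ∈ modelBoundary r) (j k : ℤ) (s : ℤ) :
    ApproxHasRasmussen r k (sphereTwist r j ∘ K) s ↔ ApproxHasRasmussen r (j + k) K s := by
  simp only [ApproxHasRasmussen, finiteApprox_sphereTwist_comp hK]

/-- **`s₋` is invariant under the sphere twists (MMSW Thm. 2.8 for `σ`)**: if `s₋(K) = s` then
`s₋(σ^j ∘ K) = s` — the representative `K'` of `K` gives the representative `σ^j ∘ K'`, whose
finite approximations are those of `K'` with `k` shifted by `j`, so the eventual value is
unchanged. [cite: ManolescuMarengonSarkarWillis2023, Thm. 2.8] -/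
theorem HasSMinus.sphereTwist_comp {K : 𝕊 1 → 𝔼 4} {s : ℤ} (h : HasSMinus r K s) (j : ℤ) :
    HasSMinus r (sphereTwist r j ∘ K) s := by
  obtain ⟨h0, K', hiso, hw, k₀, hk⟩ := h
  have hK' : IsModelKnot r K' := hiso.isModelKnot_right
  refine ⟨(isNullHomologous_sphereTwist_comp_iff K j).2 h0, sphereTwist r j ∘ K',
    hiso.sphereTwist_comp j, fun t ↦ wC_sphereTwist_ne_zero (hK'.mem t).1 (hw t) j, k₀ - j,
    fun k hjk ↦ ?_⟩
  rw [approxHasRasmussen_sphereTwist_comp_iff hK'.mem]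
  exact hk (j + k) (by omega)

/-- `s₋(σ^j ∘ K) = s ↔ s₋(K) = s`. [cite: ManolescuMarengonSarkarWillis2023, Thm. 2.8] -/
theorem hasSMinus_sphereTwist_comp_iff (K : 𝕊 1 → 𝔼 4) (j : ℤ) (s : ℤ) :
    HasSMinus r (sphereTwist r j ∘ K) s ↔ HasSMinus r K s := by
  refine ⟨fun h ↦ ?_, fun h ↦ h.sphereTwist_comp j⟩
  have hg : ∀ t, ∀ i : Fin r, (1 : ℝ) ≤ holeTerm r i (K t) := fun t i ↦ by
    have h1 := (h.isModelKnot.mem t).1 i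
    rwa [Function.comp_apply, holeTerm_sphereTwist] at h1
  have h' := h.sphereTwist_comp (-j)
  have heq : sphereTwist r (-j) ∘ (sphereTwist r j ∘ K) = K :=
    funext fun t ↦ sphereTwist_neg_sphereTwist (hg t) j
  rwa [heq] at h'

/-- `ofZW` and the mirror: `ρ (z, w) = (z̄, w)`. [folklore] -/
theorem modelMirror_ofZW (z w : ℂ) : modelMirror (ofZW z w) = ofZW (conj z) w := by
  ext i
  fin_cases i <;> simp [modelMirror]

/-- **The mirror conjugates the sphere twists**: `ρ ∘ σ^k = σ^{-k} ∘ ρ` away from the poles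
(`u(z̄) = conj u(z) = u(z)⁻¹`). [cite: ManolescuMarengonSarkarWillis2023, Prop. 8.2 (proof)] -/
theorem modelMirror_sphereTwist {x : 𝔼 4} (hx : ∀ j : Fin r, (1 : ℝ) ≤ holeTerm r j x) (k : ℤ) :
    modelMirror (sphereTwist r k x) = sphereTwist r (-k) (modelMirror x) := by
  have hz := zC_ne_holeCentre hx
  have hinv : conj (twistUnit r (zC x)) = (twistUnit r (zC x))⁻¹ := by
    rw [Complex.inv_def, Complex.normSq_eq_norm_sq, norm_twistUnit hz]
    simp
  have h2 : conj (twistUnit r (zC x)) ^ (-k) = twistUnit r (zC x) ^ k := by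
    rw [hinv, inv_zpow', neg_neg]
  rw [sphereTwist, sphereTwist, zC_modelMirror, wC_modelMirror, twistUnit_conj, h2,
    modelMirror_ofZW]

/-- **`s₊` is invariant under the sphere twists (MMSW Thm. 2.8 for `σ`)**: `s₊(σ^j ∘ K) = s ↔
s₊(K) = s`, since `ρ ∘ σ^j ∘ K = σ^{-j} ∘ (ρ ∘ K)` and `s₋` is `σ`-invariant.
[cite: ManolescuMarengonSarkarWillis2023, Thm. 2.8] -/
theorem hasSPlus_sphereTwist_comp_iff (K : 𝕊 1 → 𝔼 4) (j : ℤ) (s : ℤ) :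
    HasSPlus r (sphereTwist r j ∘ K) s ↔ HasSPlus r K s := by
  rw [hasSPlus_iff, hasSPlus_iff]
  constructor
  · intro h
    have hg : ∀ t, ∀ i : Fin r, (1 : ℝ) ≤ holeTerm r i (K t) := fun t i ↦ by
      have h1 := (h.isModelKnot.mem t).1 i
      rwa [Function.comp_apply, Function.comp_apply, holeTerm_modelMirror,
        holeTerm_sphereTwist] at h1
    have heq : modelMirror ∘ (sphereTwist r j ∘ K) = sphereTwist r (-j) ∘ (modelMirror ∘ K) :=
      funext fun t ↦ modelMirror_sphereTwist (hg t) j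
    rw [heq] at h
    exact (hasSMinus_sphereTwist_comp_iff _ _ _).1 h
  · intro h
    have hg : ∀ t, ∀ i : Fin r, (1 : ℝ) ≤ holeTerm r i (K t) := fun t i ↦ by
      have h1 := (h.isModelKnot.mem t).1 i
      rwa [Function.comp_apply, holeTerm_modelMirror] at h1
    have heq : modelMirror ∘ (sphereTwist r j ∘ K) = sphereTwist r (-j) ∘ (modelMirror ∘ K) :=
      funext fun t ↦ modelMirror_sphereTwist (hg t) j
    rw [heq]
    exact (hasSMinus_sphereTwist_comp_iff _ _ _).2 h

/-- `s₊(σ^j ∘ K) = s` from `s₊(K) = s`. [cite: ManolescuMarengonSarkarWillis2023, Thm. 2.8] -/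
theorem HasSPlus.sphereTwist_comp {K : 𝕊 1 → 𝔼 4} {s : ℤ} (h : HasSPlus r K s) (j : ℤ) :
    HasSPlus r (sphereTwist r j ∘ K) s :=
  (hasSPlus_sphereTwist_comp_iff K j s).2 h

/-- **The MMSW invariants are invariant under the sphere twists (MMSW Thm. 2.8 for `σ`)**: MMSW
invariants of `K` are MMSW invariants of `σ^j ∘ K`, with the same values. [cite: ManolescuMarengonSarkarWillis2023, Thm. 2.8] -/
theorem _root_.Literature.Topology.FourManifolds.MMSWRasmussen.nonempty_sphereTwist_comp {r : ℕ}
    {K : 𝕊 1 → 𝔼 4} (w : MMSWRasmussen r K) (j : ℤ) :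
    ∃ w' : MMSWRasmussen r (sphereTwist r j ∘ K), w'.sMinus = w.sMinus ∧ w'.sPlus = w.sPlus :=
  ⟨⟨w.sMinus, w.sPlus, w.hasSMinus.sphereTwist_comp j, w.hasSPlus.sphereTwist_comp j⟩, rfl, rfl⟩

/-! ## Isotopies through core-missing model knots give isotopic finite approximations

For the eventual value `s₋` only isotopies of `M_r` matter, and a smooth isotopy of model knots
that stays off the core circles is carried by the (smooth, there) picture map `Φ_k` to a smooth
isotopy of knots in `S³`, hence — by the isotopy extension theorem, proved in the tree
(`IsotopyExtension.lean`, through `IsRegularClosedCurve.isIsotopic_of_family`) — to an ambient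
isotopy: the finite approximations `D(k⃗)` of the two ends are the same knot in `S³` and have the
same Rasmussen invariants.  (Isotopies crossing a core circle are MMSW's surgery-wrap moves,
[MW, §3.1]; those need the stabilisation and are not treated here.) -/

/-- **Finite approximations along a core-missing isotopy are isotopic knots.**  If
`H : ℝ × 𝕊¹ → ℝ⁴` is jointly smooth, every `H_s` is a model knot missing the cores, `H_0 = K` and
`H_1 = K'`, then for every `k` the knots `D(k⃗)` of `K` and of `K'` (the knots of
`exists_knot_coe_eq_finiteApprox`) are ambient isotopic in `S³`: `(s, θ) ↦ Φ_k(H_s(cos θ, sin θ))`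
is a smooth family of regular simple closed curves (`isRegularClosedCurve_finiteApprox`), to
which the isotopy extension theorem applies (`IsRegularClosedCurve.isIsotopic_of_family`).
[cite: HirschDT1976, Ch. 8 §1, Thm. 1.3] -/
theorem exists_knot_isIsotopic_finiteApprox {K K' : 𝕊 1 → 𝔼 4} {H : ℝ → (𝕊 1) → 𝔼 4}
    (hH : ContMDiff (𝓘(ℝ, ℝ).prod (𝓡 1)) 𝓘(ℝ, 𝔼 4) ∞ (fun p : ℝ × (𝕊 1) ↦ H p.1 p.2))
    (h0 : H 0 = K) (h1 : H 1 = K') (hmk : ∀ s, IsModelKnot r (H s))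
    (hw : ∀ s t, wC (H s t) ≠ 0) (k : ℤ) :
    ∃ K₃ K₃' : Knot, ⇑K₃ = finiteApprox r k K ∧ ⇑K₃' = finiteApprox r k K' ∧
      K₃.IsIsotopic K₃' := by
  -- the family of curves
  let Γ : ℝ → ℝ → 𝔼 4 := fun u θ ↦ ((finiteApprox r k (H u) (circlePoint θ) : 𝕊 3) : 𝔼 4)
  have hreg : ∀ u, IsRegularClosedCurve (Γ u) := fun u ↦
    (hmk u).isRegularClosedCurve_finiteApprox (hw u) k
  have hleft : ∀ u θ, unpicture r k (Γ u θ) = H u (circlePoint θ) := fun u θ ↦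
    unpicture_coe_approxMap ((hmk u).mem _) (hw u _) k
  have hinj : ∀ u s t, Γ u s = Γ u t → circlePoint s = circlePoint t := fun u s t hst ↦ by
    have h := congrArg (unpicture r k) hst
    rw [hleft, hleft] at h
    exact (hmk u).2.1 h
  -- joint smoothness: `H` on `ℝ × 𝕊¹`, `circlePoint`, and the picture map off the cores
  have hHc : ContMDiff (𝓘(ℝ, ℝ).prod 𝓘(ℝ, ℝ)) 𝓘(ℝ, 𝔼 4) ∞
      (fun p : ℝ × ℝ ↦ H p.1 (circlePoint p.2)) :=
    hH.comp (contMDiff_fst.prodMk (contMDiff_circlePoint.comp contMDiff_snd))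
  have hHd : ContDiff ℝ ∞ (fun p : ℝ × ℝ ↦ H p.1 (circlePoint p.2)) := by
    rw [← contMDiff_iff_contDiff, modelWithCornersSelf_prod, ← chartedSpaceSelf_prod]
    exact hHc
  have hΓ : ContDiff ℝ ∞ (uncurry Γ) := by
    rw [contDiff_iff_contDiffAt]
    rintro ⟨u, θ⟩
    have hz : ∀ j : Fin r, zC (H u (circlePoint θ)) ≠ holeCentre r j :=
      zC_ne_holeCentre ((hmk u).mem _).1
    have h := ContDiffAt.comp (g := fun y ↦ ((approxMap r k y : 𝕊 3) : 𝔼 4))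
      (f := fun p : ℝ × ℝ ↦ H p.1 (circlePoint p.2)) (u, θ)
      (contDiffAt_coe_approxMap hz (hw u _) k) hHd.contDiffAt
    exact h
  -- the knots of the two ends, and the isotopy extension theorem
  have hiso := IsRegularClosedCurve.isIsotopic_of_family hΓ hreg hinj
  refine ⟨(hreg 0).toKnot (hinj 0), (hreg 1).toKnot (hinj 1), funext fun u ↦ ?_,
    funext fun u ↦ ?_, hiso⟩
  · obtain ⟨θ, rfl⟩ := circlePoint_surjective u
    refine Subtype.ext (((hreg 0).coe_toKnot_circlePoint (hinj 0) θ).trans ?_)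
    show ((finiteApprox r k (H 0) (circlePoint θ) : 𝕊 3) : 𝔼 4) = _
    rw [h0]
  · obtain ⟨θ, rfl⟩ := circlePoint_surjective u
    refine Subtype.ext (((hreg 1).coe_toKnot_circlePoint (hinj 1) θ).trans ?_)
    show ((finiteApprox r k (H 1) (circlePoint θ) : 𝕊 3) : 𝔼 4) = _
    rw [h1]

/-- **The Rasmussen invariants of `D(k⃗)` are constant along core-missing isotopies**: under the
hypotheses of `exists_knot_isIsotopic_finiteApprox`, `s(D(k⃗)) = s` for `K` iff for `K'`
(ambient isotopic knots have the same Rasmussen invariants,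
`Knot.HasRasmussenInvariant.of_isIsotopic`). [cite: ManolescuMarengonSarkarWillis2023, Thm. 1.3] -/
theorem approxHasRasmussen_iff_of_isotopy {K K' : 𝕊 1 → 𝔼 4} {H : ℝ → (𝕊 1) → 𝔼 4}
    (hH : ContMDiff (𝓘(ℝ, ℝ).prod (𝓡 1)) 𝓘(ℝ, 𝔼 4) ∞ (fun p : ℝ × (𝕊 1) ↦ H p.1 p.2))
    (h0 : H 0 = K) (h1 : H 1 = K') (hmk : ∀ s, IsModelKnot r (H s))
    (hw : ∀ s t, wC (H s t) ≠ 0) (k : ℤ) (s : ℤ) :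
    ApproxHasRasmussen r k K s ↔ ApproxHasRasmussen r k K' s := by
  obtain ⟨K₃, K₃', hK₃, hK₃', hiso⟩ := exists_knot_isIsotopic_finiteApprox hH h0 h1 hmk hw k
  constructor
  · rintro ⟨L, hL, hs⟩
    obtain rfl : L = K₃ := DFunLike.coe_injective (hL.trans hK₃.symm)
    exact ⟨K₃', hK₃', hs.of_isIsotopic (SphereEmbedding.IsotopyFacts.symm hiso)⟩
  · rintro ⟨L, hL, hs⟩
    obtain rfl : L = K₃' := DFunLike.coe_injective (hL.trans hK₃'.symm)
    exact ⟨K₃, hK₃, hs.of_isIsotopic hiso⟩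

/-! ## No handles (`r = 0`): the finite approximations do not depend on `k`

For `r = 0` the model is the ellipsoid `M_0 = {|z|²/40² + |w|² = 1} ≅ S³` with the single core
circle `{w = 0}`, the twist unit is the empty product `1`, every `σ^k` is the identity, and
`D(k⃗) = D(0⃗)`: the eventual-constancy statement `eventually_approxHasRasmussen` holds for `r = 0`
outright (MMSW, Ex. 8.3: for knots in `S³`, `s₋ = s₊ = s`). -/

/-- With no handles the twist unit is `1` (empty product). [folklore] -/
@[simp] theorem twistUnit_zero_left (z : ℂ) : twistUnit 0 z = 1 := by
  simp [twistUnit]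

/-- With no handles the sphere twists are the identity. [folklore] -/
@[simp] theorem sphereTwist_zero_left (k : ℤ) (x : 𝔼 4) : sphereTwist 0 k x = x := by
  simp [sphereTwist, ofZW_zC_wC]

/-- With no handles the finite approximations do not depend on `k`: `D(k⃗) = D(0⃗)`. [folklore] -/
theorem finiteApprox_zero_left (k : ℤ) (K : 𝕊 1 → 𝔼 4) :
    finiteApprox 0 k K = finiteApprox 0 0 K := by
  funext t
  simp [finiteApprox]

/-- **`eventually_approxHasRasmussen` for `r = 0`.**  For a model knot `K ⊂ M_0 ≅ S³` missing
the core circle, the Rasmussen invariants of the finite approximations are (eventually, indeed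
always) constant: `D(k⃗) = D(0⃗)` for all `k` (`finiteApprox_zero_left`), and `D(0⃗)` has a
Rasmussen invariant (`exists_approxHasRasmussen`).  The case without handles of the named fact
`eventually_approxHasRasmussen` (null-homology is automatic, `isNullHomologous_zero`); MMSW,
Ex. 8.3. [cite: ManolescuMarengonSarkarWillis2023, Ex. 8.3 and Prop. 8.2 (i)] -/
theorem exists_forall_approxHasRasmussen_zero_left {K : 𝕊 1 → 𝔼 4} (hK : IsModelKnot 0 K)
    (hw : ∀ t, wC (K t) ≠ 0) :
    ∃ (s : ℤ) (k₀ : ℤ), ∀ k, k₀ ≤ k → ApproxHasRasmussen 0 k K s := by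
  obtain ⟨s, hs⟩ := hK.exists_approxHasRasmussen hw 0
  refine ⟨s, 0, fun k _ ↦ ?_⟩
  simpa only [ApproxHasRasmussen, finiteApprox_zero_left k] using hs

/-- **Every core-missing model knot in `M_0 ≅ S³` has an `s₋`** (take `K` itself as the
representative). [cite: ManolescuMarengonSarkarWillis2023, Ex. 8.3 and Def. 8.1] -/
theorem exists_hasSMinus_zero_left {K : 𝕊 1 → 𝔼 4} (hK : IsModelKnot 0 K)
    (hw : ∀ t, wC (K t) ≠ 0) : ∃ s, HasSMinus 0 K s := by
  obtain ⟨s, k₀, hk⟩ := exists_forall_approxHasRasmussen_zero_left hK hw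
  exact ⟨s, isNullHomologous_zero K, K, IsModelIsotopic.refl hK, hw, k₀, hk⟩

end MMSW

end Literature.Topology.FourManifolds

end
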